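import Summits.MatrixMultiplication.MatrixMultiplication.Theses.ThinBlockAlpha
import Summits.MatrixMultiplication.MatrixMultiplication.Theses.GroupTheoreticSTPP

/-!
# `ThinBlockAlpha.ThinPackings` is at least as strong as `GroupTheoreticSTPP.CThesis`

Negative-side reduction for crux stmt-MatrixMultiplication-10595 (standing disprover): a thin
near-tight abelian STPP family as in `ThinPackings` beats the exponent `(2+ε)/3` for every `ε`
(take `a = 1 − ε'/4`, `η = ε'/8`, `ε' = min ε 1`: `|H| ≤ L·N^{2+η} < L·(N²M)^{(2+ε)/3}`), which is
the open target `X_C` of route GroupTheoreticSTPP (stmt-MatrixMultiplication-0593).  Hence any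
refutation of `X_C` — its negative crux `CAbelianObstructionNeg` (stmt-0596), an "all abelian
groups" barrier — refutes this crux as well.  Stated as the conditional refutation
`¬ CThesis → ¬ ThinPackings`; it settles nothing by itself.
-/

namespace Summit.MatrixMultiplication.MatrixMultiplication.Theorems.ThinPackings.Negative

open Literature.Computability.AlgebraicComplexity Finset
open Summit.MatrixMultiplication.MatrixMultiplication.Theses.ThinBlockAlpha (ThinPackings)
open Summit.MatrixMultiplication.MatrixMultiplication.Theses.GroupTheoreticSTPP (CThesis)

/-- `¬ X_C ⟹ ¬ ThinPackings` (equivalently `ThinPackings ⟹ X_C`, stmt-0593): the crux of route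
ThinBlockAlpha is at least as strong as the target of route GroupTheoreticSTPP.
[new, elementary] -/
theorem thinPackings_false_of_not_cThesis (hX : ¬ CThesis) : ¬ ThinPackings := by
  intro h
  apply hX
  intro ε hε
  set ε' : ℝ := min ε 1 with hε'
  have hε'0 : 0 < ε' := lt_min hε one_pos
  have hε'1 : ε' ≤ 1 := min_le_right _ _
  have hε'ε : ε' ≤ ε := min_le_left _ _
  obtain ⟨H, i1, i2, L, N, M, A, B, C, hS, hc, hN, hM, hH⟩ :=
    h (1 - ε' / 4) (by linarith) (by linarith) (ε' / 8) (by positivity)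
  refine ⟨H, i1, i2, L, A, B, C, hS, ?_⟩
  have hL : 1 ≤ L := by
    by_contra h0
    have hL0 : L = 0 := by omega
    rw [hL0, Nat.cast_zero, zero_mul] at hH
    have : (0 : ℝ) < Fintype.card H := by exact_mod_cast Fintype.card_pos
    linarith
  have hLpos : (0 : ℝ) < L := by exact_mod_cast (by omega : 0 < L)
  have hN1 : (1 : ℝ) < N := by exact_mod_cast (by omega : 1 < N)
  have hNpos : (0 : ℝ) < N := by linarith
  have hsum : ∑ i : Fin L, (((A i).card * (B i).card * (C i).card : ℕ) : ℝ) ^ ((2 + ε) / 3) =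
      L * (((N * M * N : ℕ) : ℝ) ^ ((2 + ε) / 3)) := by
    rw [Finset.sum_congr rfl fun i _ => by rw [(hc i).1, (hc i).2.1, (hc i).2.2], sum_const,
      card_univ, Fintype.card_fin, nsmul_eq_mul]
  rw [hsum]
  have hvol : (N : ℝ) ^ (2 + (1 - ε' / 4)) ≤ ((N * M * N : ℕ) : ℝ) := by
    rw [Real.rpow_add hNpos, Real.rpow_two]
    push_cast
    calc (N : ℝ) ^ 2 * (N : ℝ) ^ (1 - ε' / 4) ≤ (N : ℝ) ^ 2 * (M : ℝ) := by gcongr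
      _ = (N : ℝ) * M * N := by ring
  have hexp_pos : (0 : ℝ) < (2 + ε) / 3 := by positivity
  have hlt : 2 + ε' / 8 < (2 + (1 - ε' / 4)) * ((2 + ε) / 3) := by
    nlinarith [mul_nonneg hε'0.le hε'0.le]
  calc (Fintype.card H : ℝ) ≤ L * (N : ℝ) ^ (2 + ε' / 8) := hH
    _ < L * (N : ℝ) ^ ((2 + (1 - ε' / 4)) * ((2 + ε) / 3)) :=
        mul_lt_mul_of_pos_left (Real.rpow_lt_rpow_of_exponent_lt hN1 hlt) hLpos
    _ ≤ L * ((N * M * N : ℕ) : ℝ) ^ ((2 + ε) / 3) := by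
        refine mul_le_mul_of_nonneg_left ?_ hLpos.le
        rw [Real.rpow_mul hNpos.le]
        exact Real.rpow_le_rpow (by positivity) hvol hexp_pos.le

end Summit.MatrixMultiplication.MatrixMultiplication.Theorems.ThinPackings.Negative
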